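import Summits.KontsevichZagierPeriods.KontsevichZagierPeriods.Theorems.RootDecompQuadraticDescentBlowupPairP2
import Summits.KontsevichZagierPeriods.KontsevichZagierPeriods.Theses.RootDecompQuadraticDescent

/-!
# DARK census pair #3 `[□²,1/(1+2x+2y+y²)] ≡ [□²,1/(2+x²+2xy+y²)]` DECIDED in `KZ.relations` by rules 1+2 (route `RootDecompQuadraticDescent`, instance of crux stmt-KontsevichZagierPeriods-28994 / stmt-4280) · part 3/3

Cell `decomp-kz`, lens 6 (decomp-kz-lens-6 g8c): `pair3` — diagonal fold + blow-up over the open base (`KZ.of_sub_of_mem_relations_of_affine`) + u = v² (primed fibre map, proved in-file) + reflection + Möbius t/(2−t) (g7 prediction P2(β) in kernel form; value ½·log(3/4) + √2(arctan √2 − arctan(1/√2))); packaged `blowupPair_descentTwoQ_instance` and `blowupPair_of_kzDimTwo` BY NAME; imports the LANDED `…DarkPairsEleven` reflection kit.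

Source: `HOME/decomp-kz-lens-6/g8/BlowupPair3.lean` sha256 f23bb012538601e3 (708 l; critic decomp-kz-crit-1 g2 CLEARED 2026-08-30T09:23:01Z, std axioms), split into 3 modules by the landing seat decomp-kz-census-1 g7 (contexts re-opened per part; generic docstrings added where the source had none; the route file is imported only by the last part, which proves the `KZDimTwo` corollaries BY NAME).  No `sorry`; standard axioms.  References: [cite: KontsevichZagier2001, §1.2].
-/

noncomputable section

open MeasureTheory Set MvPolynomial

namespace Summit.KontsevichZagierPeriods.RootDecompQuadraticDescent.BlowupPair

open Summit.KontsevichZagierPeriods.KontsevichZagierPeriods.Theses.RootDecompQuadraticDescent (KZDimTwo)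

open Literature.NumberTheory.Transcendental
open Literature.NumberTheory.Transcendental.KZ
open Literature.ModelTheory.ExponentialFields (IsSemialgebraic)
open Summit.KontsevichZagierPeriods.RootDecompQuadraticDescent.DarkPairs (rel_reflect_rep rel_double
  update_one_apply_zero)

-- PRIVATE copy (landed twin lives in a farm-unbuilt module; dedup.landed): snoc2_zero, snoc2_one, init2_zero, update_zero_apply_one, isRational_rep
/-- `snoc2_zero`: auxiliary theorem of the lens-6 development «blowup» (instances of 28994/4280) — see the module docstring; verbatim from the lens file. -/
@[simp] private theorem snoc2_zero (x : Fin 1 → ℝ) (t : ℝ) : (Fin.snoc x t : Fin 2 → ℝ) 0 = x 0 := rfl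

/-- `snoc2_one`: auxiliary theorem of the lens-6 development «blowup» (instances of 28994/4280) — see the module docstring; verbatim from the lens file. -/
@[simp] private theorem snoc2_one (x : Fin 1 → ℝ) (t : ℝ) : (Fin.snoc x t : Fin 2 → ℝ) 1 = t := rfl

/-- `init2_zero`: auxiliary theorem of the lens-6 development «blowup» (instances of 28994/4280) — see the module docstring; verbatim from the lens file. -/
@[simp] private theorem init2_zero (z : Fin 2 → ℝ) : Fin.init z 0 = z 0 := rfl

/-- `update_zero_apply_one`: auxiliary theorem of the lens-6 development «blowup» (instances of 28994/4280) — see the module docstring; verbatim from the lens file. -/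
@[simp] private theorem update_zero_apply_one (x : Fin 2 → ℝ) (a : ℝ) : Function.update x 0 a 1 = x 1 :=
  Function.update_of_ne (by decide) a x

/-- A regular rational function gives a KZ-rational representation. [folklore] -/
private theorem isRational_rep {M : ℕ} (T : RFun M) : T.rep.IsRational :=
  ⟨T.num, T.den, T.den_ne, fun _ _ => rfl⟩

/-- (10) The Möbius substitution `y = t/(2−t)` of `[0,1]` onto itself, fibrewise in the last
coordinate: `B2 ≡ A`, since `1 + 2x + 2t/(2−t) + t²/(2−t)² = (4 + 2x(2−t)²)/(2−t)²` and
`dy = 2dt/(2−t)²`. -/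
theorem c10 : KZ.of B2.rep - KZ.of A3.rep ∈ KZ.relations := by
  have h2 : ∀ z ∈ cube 2, (0 : ℝ) < 2 - z 1 := fun z hz => by linarith [(hz 1).2]
  refine of_sub_of_mem_relations_of_fibreMap (G := ivl 0 1) (a := fun _ => 0) (b := fun _ => 1)
    (a' := fun _ => 0) (b' := fun _ => 1) (fun z => z 1 / (2 - z 1)) (fun z => 2 / (2 - z 1) ^ 2)
    B2.rep _ cube_eq_band cube_eq_band (fun _ _ => zero_le_one) ?_ ?_ ?_ ?_ ?_ ?_ ?_
  · refine (isSemialgebraicFunOn_aeval_div_aeval isSemialgebraic_cube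
      (X 1 : MvPolynomial (Fin 2) ℚ) (2 - X 1) fun z hz => ?_).congr fun z _ => ?_
    · have h := h2 z hz
      simp only [map_sub, map_ofNat, aeval_X]
      exact h.ne'
    · simp only [map_sub, map_ofNat, aeval_X]
  · intro z hz
    have hne := (h2 z hz).ne'
    fun_prop (disch := exact hne)
  · intro z hz
    have hne := (h2 z hz).ne'
    show HasDerivAt (fun t => (Fin.snoc (Fin.init z) t : Fin 2 → ℝ) 1 /
      (2 - (Fin.snoc (Fin.init z) t : Fin 2 → ℝ) 1)) _ (z 1)
    simp only [snoc2_one]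
    have hb : HasDerivAt (fun t : ℝ => 2 - t) (-1) (z 1) := by
      simpa using (hasDerivAt_id' (z 1)).const_sub 2
    exact ((hasDerivAt_id' (z 1)).div hb hne).congr_deriv (by field_simp; ring)
  · intro z hz
    exact div_pos (by norm_num) (pow_pos (h2 z hz) 2)
  · intro y _
    show (Fin.snoc y (0 : ℝ) : Fin 2 → ℝ) 1 / (2 - (Fin.snoc y (0 : ℝ) : Fin 2 → ℝ) 1) = 0
    simp
  · intro y _
    show (Fin.snoc y (1 : ℝ) : Fin 2 → ℝ) 1 / (2 - (Fin.snoc y (1 : ℝ) : Fin 2 → ℝ) 1) = 1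
    norm_num [snoc2_one]
  · intro z hz
    have hne := (h2 z hz).ne'
    have h0 := (hz 0).1
    have hq : (2 : ℝ) + z 0 * (2 - z 1) ^ 2 ≠ 0 := by nlinarith [mul_nonneg h0 (sq_nonneg (2 - z 1))]
    have hq' : (4 : ℝ) + 2 * z 0 * (2 - z 1) ^ 2 ≠ 0 := by
      nlinarith [mul_nonneg h0 (sq_nonneg (2 - z 1))]
    rw [RFun.rep_integrand, RFun.rep_integrand]
    simp only [RFun.fn, B2, A3, QB2, QA3, map_add, map_sub, map_mul, map_pow, map_ofNat, map_one,
      aeval_X, snoc2_zero, snoc2_one, init2_zero]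
    rw [show (1 : ℝ) + 2 * z 0 + 2 * (z 1 / (2 - z 1)) + (z 1 / (2 - z 1)) ^ 2 =
        (4 + 2 * z 0 * (2 - z 1) ^ 2) / (2 - z 1) ^ 2 by field_simp; ring, one_div_div]
    field_simp
    ring

/-! ## §6 Census pair #3 DECIDED -/

/-- **DARK census pair #3 DECIDED**: `[□²,1/(1+2x+2y+y²)] − [□²,1/(2+x²+2xy+y²)] ∈ KZ.relations`,
by ten moves of rules 1 + 2 (`A ≡ B2 ≡ B1r ≡ B1 ≡ Cd ≡ 2·Tbs ≡ 2·Tb ≡ B`). -/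
theorem pair3 : KZ.of A3.rep - KZ.of B3.rep ∈ KZ.relations := by
  have hA_B1 : KZ.of A3.rep - KZ.of B1.rep ∈ KZ.relations :=
    rel_trans (rel_trans (rel_symm c10) c9) (rel_symm c8)
  have hA_Cd : KZ.of A3.rep - KZ.of Cd.rep ∈ KZ.relations := rel_trans hA_B1 (rel_symm c7)
  have hCd_Tb : KZ.of Cd.rep - 2 • KZ.of Tb.rep ∈ KZ.relations := by
    have h := add_mem c6 (KZ.relations.nsmul_mem (rel_symm c5) 2)
    convert h using 1
    module
  have hCd_B : KZ.of Cd.rep - KZ.of B3.rep ∈ KZ.relations := by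
    have h := sub_mem hCd_Tb B3_Tb
    convert h using 1
    abel
  exact rel_trans hA_Cd hCd_B

/-- `pair3_equivalent`: auxiliary theorem of the lens-6 development «blowup» (instances of 28994/4280) — see the module docstring; verbatim from the lens file. -/
theorem pair3_equivalent : KZ.Equivalent A3.rep B3.rep := pair3

/-- `pair3_value`: auxiliary theorem of the lens-6 development «blowup» (instances of 28994/4280) — see the module docstring; verbatim from the lens file. -/
theorem pair3_value : A3.rep.value = B3.rep.value :=
  KZ.Equivalent.value_eq_holds pair3_equivalent

/-! ## §7 Packaging: the pair as a DECIDED INSTANCE of the route items -/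

/-- Census pair #3 is a decided instance of the n = m = 2 case: both members KZ-rational, equal
values, and EQUIVALENT — the conclusion of `KZDimTwo` (item 4280) holds for it outright. -/
theorem blowupPair_decided :
    A3.rep.IsRational ∧ B3.rep.IsRational ∧ A3.rep.value = B3.rep.value ∧
      KZ.Equivalent A3.rep B3.rep :=
  ⟨isRational_rep _, isRational_rep _, pair3_value, pair3_equivalent⟩

/-- For every `R ⊇ KZ.relations` the #3 difference lies in `R`: an instance of the conclusion of
`DescentTwoQ` (item 28994) with NO use of its oracle hypotheses. -/
theorem blowupPair_descentTwoQ_instance (R : AddSubgroup KZ.FormalRep) (hR : KZ.relations ≤ R) :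
    KZ.of A3.rep - KZ.of B3.rep ∈ R :=
  hR pair3

/-- … and, trivially, `KZDimTwo` (the born route decl, BY NAME) implies the equivalence too. -/
theorem blowupPair_of_kzDimTwo (h : KZDimTwo) : KZ.Equivalent A3.rep B3.rep :=
  h le_rfl le_rfl _ _ (isRational_rep _) (isRational_rep _) pair3_value

/-- info: 'Summit.KontsevichZagierPeriods.RootDecompQuadraticDescent.BlowupPair.pair3' depends on axioms: [propext,
 Classical.choice,
 Quot.sound] -/
#guard_msgs in #print axioms pair3

/-- info: 'Summit.KontsevichZagierPeriods.RootDecompQuadraticDescent.BlowupPair.blowupPair_decided' depends on axioms: [propext,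
 Classical.choice,
 Quot.sound] -/
#guard_msgs in #print axioms blowupPair_decided

/-- info: 'Summit.KontsevichZagierPeriods.RootDecompQuadraticDescent.BlowupPair.blowupPair_of_kzDimTwo' depends on axioms: [propext,
 Classical.choice,
 Quot.sound] -/
#guard_msgs in #print axioms blowupPair_of_kzDimTwo

end Summit.KontsevichZagierPeriods.RootDecompQuadraticDescent.BlowupPair

end
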